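import Literature.Geometry.Kaehler.ManifoldFormsChart
import HarnessLib

/-!
# Differential forms on open subsets of a manifold and their de Rham cohomology

Support for the finite-dimensionality of de Rham cohomology
(`Literature.AlgebraicGeometry.Motives.finite_deRhamCohomology`; Mayer–Vietoris route).

For an open subset `U` of a manifold `M` we do NOT pass to the open submanifold `↥U`; instead a
`k`-form *on `U`* is a form on `M` that is smooth at every point of `U` and vanishes off `U`
(`smoothFormsOn U k`, a submodule of `MForm I M F k`). Restriction to a smaller open set is
"multiplication by the indicator" (`MForm.restr`), the exterior derivative on `U` is
`localD U k α = restr U (d α)` (so that nothing is asserted about the non-smooth points of the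
boundary), `d ∘ d = 0` holds on `U` (`localD_localD`), and the de Rham cohomology of `U` is
`LocalDeRham U k = ker d / im d` with restriction maps `LocalDeRham.res` (functorial:
`res_comp`, `res_self`). For `U = univ` the local complex is the complex
`smoothForms / closedSmoothForms / exactSmoothForms` of `Literature.Geometry.Kaehler.ManifoldForms`,
and `LocalDeRham univ k` surjects onto `deRhamCohomology I M F k`
(`LocalDeRham.toDeRhamCohomology_surjective`), so finiteness statements transfer
(`finite_deRhamCohomology_of_finite_localDeRham_univ`).

All of this is elementary bookkeeping on top of the pointwise calculus of
`Literature.Geometry.Kaehler.ManifoldFormsChart` (locality of smoothness and of `d`, smoothness of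
`dα`, `d (dα) = 0` at points near which `α` is smooth).

## References

* R. Bott, L. W. Tu, *Differential Forms in Algebraic Topology* (1982), §I.1–I.2 (the de Rham
  complex of an open subset, restriction maps).
* J. M. Lee, *Introduction to Smooth Manifolds*, 2nd ed. (2013), Ch. 17 (pp. 440–443).
-/

noncomputable section

open scoped Manifold ContDiff Topology
open Bundle Set Filter

namespace Literature.Geometry.Kaehler

variable {E : Type*} [NormedAddCommGroup E] [NormedSpace ℝ E]
  {H : Type*} [TopologicalSpace H] {I : ModelWithCorners ℝ E H}
  {M : Type*} [TopologicalSpace M] [ChartedSpace H M]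
  {F : Type*} [NormedAddCommGroup F] [NormedSpace ℝ F] {k : ℕ}

/-! ### Restriction (extension by zero) -/

namespace MForm

open Classical in
/-- Restriction of a form to a subset `U`, extended by zero: `α` on `U`, `0` off `U`.
[folklore] -/
def restr (U : Set M) (α : MForm I M F k) : MForm I M F k := fun x ↦ if x ∈ U then α x else 0

/-- On `U` the restriction is the form. [folklore] -/
@[simp]
theorem restr_apply_of_mem {U : Set M} (α : MForm I M F k) {x : M} (hx : x ∈ U) :
    α.restr U x = α x := by
  simp [restr, hx]

/-- Off `U` the restriction vanishes. [folklore] -/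
@[simp]
theorem restr_apply_of_notMem {U : Set M} (α : MForm I M F k) {x : M} (hx : x ∉ U) :
    α.restr U x = 0 := by
  simp [restr, hx]

/-- Restriction to `univ` is the identity. [folklore] -/
@[simp]
theorem restr_univ (α : MForm I M F k) : α.restr univ = α := by
  funext x
  simp [restr]

/-- Restricting twice is restricting to the intersection. [folklore] -/
theorem restr_restr (U V : Set M) (α : MForm I M F k) : (α.restr V).restr U = α.restr (U ∩ V) := by
  funext x
  by_cases hU : x ∈ U <;> by_cases hV : x ∈ V <;> simp [restr, hU, hV]

/-- Restricting to `U ⊆ V` after `V` is restricting to `U`. [folklore] -/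
theorem restr_restr_of_subset {U V : Set M} (h : U ⊆ V) (α : MForm I M F k) :
    (α.restr V).restr U = α.restr U := by
  rw [restr_restr, inter_eq_left.2 h]

/-- Restriction is additive. [folklore] -/
@[simp]
theorem restr_add (U : Set M) (α β : MForm I M F k) : (α + β).restr U = α.restr U + β.restr U := by
  funext x
  by_cases hx : x ∈ U <;> simp [restr, hx]

/-- Restriction commutes with scalars. [folklore] -/
@[simp]
theorem restr_smul (U : Set M) (c : ℝ) (α : MForm I M F k) : (c • α).restr U = c • α.restr U := by
  funext x
  by_cases hx : x ∈ U <;> simp [restr, hx]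

/-- Restriction of the zero form. [folklore] -/
@[simp]
theorem restr_zero (U : Set M) : (0 : MForm I M F k).restr U = 0 := by
  funext x
  by_cases hx : x ∈ U <;> simp [restr, hx]

/-- Restriction is negation-compatible. [folklore] -/
@[simp]
theorem restr_neg (U : Set M) (α : MForm I M F k) : (-α).restr U = -α.restr U := by
  funext x
  by_cases hx : x ∈ U <;> simp [restr, hx]

/-- Restriction is subtraction-compatible. [folklore] -/
@[simp]
theorem restr_sub (U : Set M) (α β : MForm I M F k) : (α - β).restr U = α.restr U - β.restr U := by
  simp [sub_eq_add_neg]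

/-- Near a point of an open set `U`, the restriction to `U` agrees with the form. [folklore] -/
theorem restr_eventuallyEq {U : Set M} (hU : IsOpen U) (α : MForm I M F k) {x : M} (hx : x ∈ U) :
    ∀ᶠ y in 𝓝 x, α.restr U y = α y := by
  filter_upwards [hU.mem_nhds hx] with y hy
  exact restr_apply_of_mem α hy

/-- A form that vanishes off `U` is its own restriction to `U`. [folklore] -/
theorem restr_eq_self {U : Set M} {α : MForm I M F k} (h : ∀ x ∉ U, α x = 0) : α.restr U = α := by
  funext x
  by_cases hx : x ∈ U
  · exact restr_apply_of_mem α hx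
  · rw [restr_apply_of_notMem α hx, h x hx]

end MForm

/-- Near a point of an open set `U`, smoothness of the restriction is smoothness of the form.
[folklore] -/
theorem MForm.smoothAt_restr_iff {U : Set M} (hU : IsOpen U) (α : MForm I M F k) {x : M}
    (hx : x ∈ U) : (α.restr U).SmoothAt x ↔ α.SmoothAt x :=
  MForm.smoothAt_congr_of_eventuallyEq (MForm.restr_eventuallyEq hU α hx)

/-- Near a point of an open set `U`, `d` of the restriction is `d` of the form. [folklore] -/
theorem mextDeriv_restr_apply {U : Set M} (hU : IsOpen U) (α : MForm I M F k) {x : M}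
    (hx : x ∈ U) : mextDeriv (α.restr U) x = mextDeriv α x :=
  mextDeriv_congr_of_eventuallyEq (MForm.restr_eventuallyEq hU α hx)

/-! ### Pointwise linearity of `d` -/

/-- `d` is additive at a point at which both forms are smooth. [folklore] -/
theorem mextDeriv_add_apply {α β : MForm I M F k} {x : M} (hα : α.SmoothAt x) (hβ : β.SmoothAt x) :
    mextDeriv (α + β) x = mextDeriv α x + mextDeriv β x := by
  have hU : UniqueDiffWithinAt ℝ (range I) (extChartAt I x x) :=
    I.uniqueDiffOn _ (extChartAt_target_subset_range x (mem_extChartAt_target x))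
  simp only [mextDeriv, MForm.inChart_add]
  rw [extDerivWithin_add hU (hα.differentiableWithinAt (by simp))
    (hβ.differentiableWithinAt (by simp))]
  rfl

/-- `d` vanishes at a point near which the form vanishes. [folklore] -/
theorem mextDeriv_apply_eq_zero_of_eventuallyEq_zero {α : MForm I M F k} {x : M}
    (h : ∀ᶠ y in 𝓝 x, α y = 0) : mextDeriv α x = 0 := by
  rw [mextDeriv_congr_of_eventuallyEq (β := 0) h, mextDeriv_zero]
  rfl

/-! ### Smooth forms on an open set -/

variable (I F) in
/-- **The `k`-forms on a subset `U ⊆ M`**: forms on `M` that are smooth at every point of `U`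
and vanish off `U` (for `U` open this is the space `Ωᵏ(U)` of smooth `k`-forms on the open
submanifold `U`, realised inside `MForm I M F k` by extension by zero). Bott–Tu (1982), §I.1.
[cite: BottTu1982Forms, §I.1] -/
def smoothFormsOn (U : Set M) (k : ℕ) : Submodule ℝ (MForm I M F k) where
  carrier := {α | (∀ x ∈ U, α.SmoothAt x) ∧ ∀ x ∉ U, α x = 0}
  add_mem' {α β} hα hβ := ⟨fun x hx ↦ (hα.1 x hx).add (hβ.1 x hx),
    fun x hx ↦ by rw [Pi.add_apply, hα.2 x hx, hβ.2 x hx, add_zero]⟩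
  zero_mem' := ⟨fun x _ ↦ MForm.smoothAt_zero x, fun _ _ ↦ rfl⟩
  smul_mem' c α hα := ⟨fun x hx ↦ (hα.1 x hx).smul c,
    fun x hx ↦ by rw [Pi.smul_apply, hα.2 x hx, smul_zero]⟩

/-- Membership in `smoothFormsOn`. [folklore] -/
theorem mem_smoothFormsOn_iff {U : Set M} {α : MForm I M F k} :
    α ∈ smoothFormsOn I F U k ↔ (∀ x ∈ U, α.SmoothAt x) ∧ ∀ x ∉ U, α x = 0 :=
  Iff.rfl

/-- A form on `U` is its own restriction to `U`. [folklore] -/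
theorem restr_eq_self_of_mem {U : Set M} {α : MForm I M F k} (hα : α ∈ smoothFormsOn I F U k) :
    α.restr U = α :=
  MForm.restr_eq_self hα.2

/-- Forms on `univ` are the smooth forms of `ManifoldForms`. [folklore] -/
theorem smoothFormsOn_univ : smoothFormsOn I F (univ : Set M) k = smoothForms I M F k := by
  ext α
  simp only [mem_smoothFormsOn_iff, mem_univ, forall_const, not_true_eq_false, IsEmpty.forall_iff,
    implies_true, and_true, mem_smoothForms_iff]
  rfl

/-- **Restriction to a smaller open set** `U ⊆ V` maps forms on `V` to forms on `U`
(Bott–Tu (1982), §I.1: the restriction map of the de Rham complex). [cite: BottTu1982Forms, §I.1] -/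
theorem restr_mem_smoothFormsOn {U V : Set M} (hU : IsOpen U) (hUV : U ⊆ V) {α : MForm I M F k}
    (hα : α ∈ smoothFormsOn I F V k) : α.restr U ∈ smoothFormsOn I F U k :=
  ⟨fun x hx ↦ (MForm.smoothAt_restr_iff hU α hx).2 (hα.1 x (hUV hx)),
    fun _ hx ↦ MForm.restr_apply_of_notMem α hx⟩

variable (I F k) in
/-- The restriction map `Ωᵏ(V) → Ωᵏ(U)` for open `U ⊆ V`, as a linear map. [cite: BottTu1982Forms, §I.1] -/
def restrictₗ {U V : Set M} (hU : IsOpen U) (hUV : U ⊆ V) :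
    smoothFormsOn I F V k →ₗ[ℝ] smoothFormsOn I F U k where
  toFun α := ⟨(α : MForm I M F k).restr U, restr_mem_smoothFormsOn hU hUV α.2⟩
  map_add' _ _ := Subtype.ext (MForm.restr_add U _ _)
  map_smul' c _ := Subtype.ext (MForm.restr_smul U c _)

/-- Underlying form of a restriction. [folklore] -/
@[simp]
theorem coe_restrictₗ {U V : Set M} (hU : IsOpen U) (hUV : U ⊆ V) (α : smoothFormsOn I F V k) :
    (restrictₗ I F k hU hUV α : MForm I M F k) = (α : MForm I M F k).restr U :=
  rfl

/-! ### The exterior derivative on an open set -/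

/-- A form on an open set `U` is smooth near each point of `U`. [folklore] -/
theorem eventually_smoothAt_of_mem {U : Set M} (hU : IsOpen U) {α : MForm I M F k}
    (hα : α ∈ smoothFormsOn I F U k) {x : M} (hx : x ∈ U) : ∀ᶠ y in 𝓝 x, α.SmoothAt y := by
  filter_upwards [hU.mem_nhds hx] with y hy
  exact hα.1 y hy

section Deriv

variable [IsManifold I ∞ M]

/-- `d` of a form on an open set `U`, restricted to `U`, is a form on `U`. [folklore] -/
theorem restr_mextDeriv_mem {U : Set M} (hU : IsOpen U) {α : MForm I M F k}
    (hα : α ∈ smoothFormsOn I F U k) : (mextDeriv α).restr U ∈ smoothFormsOn I F U (k + 1) :=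
  ⟨fun _ hx ↦ (MForm.smoothAt_restr_iff hU _ hx).2
      (MForm.SmoothAt.mextDeriv (eventually_smoothAt_of_mem hU hα hx)),
    fun _ hx ↦ MForm.restr_apply_of_notMem _ hx⟩

variable (I F k) in
/-- **The exterior derivative of the de Rham complex of an open set** `U`:
`d_U α = restr U (dα)` (the values of `dα` off `U` are discarded). Bott–Tu (1982), §I.1.
[cite: BottTu1982Forms, §I.1] -/
def localD {U : Set M} (hU : IsOpen U) : smoothFormsOn I F U k →ₗ[ℝ] smoothFormsOn I F U (k + 1) where
  toFun α := ⟨(mextDeriv (α : MForm I M F k)).restr U, restr_mextDeriv_mem hU α.2⟩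
  map_add' α β := by
    refine Subtype.ext (funext fun x ↦ ?_)
    by_cases hx : x ∈ U
    · simp only [Submodule.coe_add, MForm.restr_apply_of_mem _ hx, Pi.add_apply]
      exact mextDeriv_add_apply (α.2.1 x hx) (β.2.1 x hx)
    · simp only [Submodule.coe_add, MForm.restr_apply_of_notMem _ hx, Pi.add_apply, add_zero]
  map_smul' c α := by
    refine Subtype.ext ?_
    simp only [Submodule.coe_smul, mextDeriv_smul, MForm.restr_smul, RingHom.id_apply]

/-- Underlying form of `d_U α`. [folklore] -/
@[simp]
theorem coe_localD {U : Set M} (hU : IsOpen U) (α : smoothFormsOn I F U k) :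
    (localD I F k hU α : MForm I M F (k + 1)) = (mextDeriv (α : MForm I M F k)).restr U :=
  rfl

/-- On `U`, `d_U α` is `dα`. [folklore] -/
theorem localD_apply_of_mem {U : Set M} (hU : IsOpen U) (α : smoothFormsOn I F U k) {x : M}
    (hx : x ∈ U) : (localD I F k hU α : MForm I M F (k + 1)) x = mextDeriv (α : MForm I M F k) x :=
  MForm.restr_apply_of_mem _ hx

/-- **`d ∘ d = 0` on an open set.** [cite: BottTu1982Forms, §I.1] -/
theorem localD_localD {U : Set M} (hU : IsOpen U) (α : smoothFormsOn I F U k) :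
    localD I F (k + 1) hU (localD I F k hU α) = 0 := by
  refine Subtype.ext (funext fun x ↦ ?_)
  by_cases hx : x ∈ U
  · rw [coe_localD, MForm.restr_apply_of_mem _ hx, coe_localD, mextDeriv_restr_apply hU _ hx]
    exact mextDeriv_mextDeriv_of_smoothAt (eventually_smoothAt_of_mem hU α.2 hx)
  · rw [coe_localD, MForm.restr_apply_of_notMem _ hx]
    rfl

/-- **Restriction commutes with `d`**: `d_U (α|_U) = (d_V α)|_U` for open `U ⊆ V`
(naturality of `d` under open inclusions; Bott–Tu (1982), §I.1). [cite: BottTu1982Forms, §I.1] -/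
theorem localD_restrictₗ {U V : Set M} (hU : IsOpen U) (hV : IsOpen V) (hUV : U ⊆ V)
    (α : smoothFormsOn I F V k) :
    localD I F k hU (restrictₗ I F k hU hUV α) = restrictₗ I F (k + 1) hU hUV (localD I F k hV α) := by
  refine Subtype.ext (funext fun x ↦ ?_)
  by_cases hx : x ∈ U
  · simp only [coe_localD, coe_restrictₗ, MForm.restr_apply_of_mem _ hx]
    rw [mextDeriv_restr_apply hU _ hx, MForm.restr_apply_of_mem _ (hUV hx)]
  · simp only [coe_localD, coe_restrictₗ, MForm.restr_apply_of_notMem _ hx]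

/-! ### Closed and exact forms, cohomology of an open set -/

variable (I F k) in
/-- **Closed `k`-forms on the open set `U`**: forms on `U` whose exterior derivative vanishes on
`U` (`ker d_U`, as a submodule of all forms). [cite: BottTu1982Forms, §I.1] -/
def localClosedForms (U : Set M) : Submodule ℝ (MForm I M F k) where
  carrier := {α | α ∈ smoothFormsOn I F U k ∧ ∀ x ∈ U, mextDeriv α x = 0}
  add_mem' {α β} hα hβ := ⟨add_mem hα.1 hβ.1, fun x hx ↦ by
    rw [mextDeriv_add_apply (hα.1.1 x hx) (hβ.1.1 x hx), hα.2 x hx, hβ.2 x hx, add_zero]⟩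
  zero_mem' := ⟨zero_mem _, fun _ _ ↦ by rw [mextDeriv_zero]; rfl⟩
  smul_mem' c α hα := ⟨Submodule.smul_mem _ c hα.1, fun x hx ↦ by
    rw [mextDeriv_smul, Pi.smul_apply, hα.2 x hx, smul_zero]⟩

omit [IsManifold I ∞ M] in
/-- Membership in `localClosedForms`. [folklore] -/
theorem mem_localClosedForms_iff {U : Set M} {α : MForm I M F k} :
    α ∈ localClosedForms I F k U ↔ α ∈ smoothFormsOn I F U k ∧ ∀ x ∈ U, mextDeriv α x = 0 :=
  Iff.rfl

omit [IsManifold I ∞ M] in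
/-- Closed forms on `U` are forms on `U`. [folklore] -/
theorem localClosedForms_le_smoothFormsOn {U : Set M} :
    localClosedForms I F k U ≤ smoothFormsOn I F U k := fun _ hα ↦ hα.1

/-- A form on `U` is closed on `U` iff `d_U` kills it. [folklore] -/
theorem mem_localClosedForms_iff_localD_eq_zero {U : Set M} (hU : IsOpen U)
    (α : smoothFormsOn I F U k) :
    (α : MForm I M F k) ∈ localClosedForms I F k U ↔ localD I F k hU α = 0 := by
  rw [mem_localClosedForms_iff, Subtype.ext_iff]
  constructor
  · rintro ⟨-, h⟩
    funext x
    by_cases hx : x ∈ U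
    · rw [coe_localD, MForm.restr_apply_of_mem _ hx, h x hx]; rfl
    · rw [coe_localD, MForm.restr_apply_of_notMem _ hx]; rfl
  · intro h
    refine ⟨α.2, fun x hx ↦ ?_⟩
    have := congrFun h x
    rwa [coe_localD, MForm.restr_apply_of_mem _ hx] at this

variable (I F) in
/-- **Exact `k`-forms on the open set `U`**: `0` in degree `0`, and `{d_U β | β ∈ Ωᵏ(U)}` in
degree `k + 1` (the range of `d_U`, as a submodule of all forms; pattern matching on the degree
avoids `k - 1`). [cite: BottTu1982Forms, §I.1] -/
def localExactForms {U : Set M} (hU : IsOpen U) : (k : ℕ) → Submodule ℝ (MForm I M F k)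
  | 0 => ⊥
  | k + 1 => LinearMap.range ((smoothFormsOn I F U (k + 1)).subtype ∘ₗ localD I F k hU)

/-- Membership in `localExactForms` in positive degree: being `d_U` of a form on `U`.
[folklore] -/
theorem mem_localExactForms_succ_iff {U : Set M} (hU : IsOpen U) {α : MForm I M F (k + 1)} :
    α ∈ localExactForms I F hU (k + 1) ↔
      ∃ β : smoothFormsOn I F U k, (localD I F k hU β : MForm I M F (k + 1)) = α := by
  simp [localExactForms]

/-- Exact forms on `U` are closed on `U` (`d ∘ d = 0`). [cite: BottTu1982Forms, §I.1] -/
theorem localExactForms_le_localClosedForms {U : Set M} (hU : IsOpen U) :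
    localExactForms I F hU k ≤ localClosedForms I F k U := by
  cases k with
  | zero => exact bot_le
  | succ k =>
    intro α hα
    obtain ⟨β, rfl⟩ := (mem_localExactForms_succ_iff hU).1 hα
    rw [mem_localClosedForms_iff_localD_eq_zero hU]
    exact localD_localD hU β

/-- Exact forms on `U` are forms on `U`. [folklore] -/
theorem localExactForms_le_smoothFormsOn {U : Set M} (hU : IsOpen U) :
    localExactForms I F hU k ≤ smoothFormsOn I F U k :=
  (localExactForms_le_localClosedForms hU).trans localClosedForms_le_smoothFormsOn

variable (I F k) in
/-- **The de Rham cohomology of the open set `U`**: closed forms on `U` modulo exact ones,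
`H^k_dR(U) = ker d_U / im d_U` (same construction as `deRhamCohomology` in `ManifoldForms`).
Bott–Tu (1982), §I.1; Lee (2013), p. 441. [cite: BottTu1982Forms, §I.1] -/
def LocalDeRham {U : Set M} (hU : IsOpen U) : Type _ :=
  ↥(localClosedForms I F k U) ⧸ (localExactForms I F hU k).comap (localClosedForms I F k U).subtype

namespace LocalDeRham

/-- The additive group structure (quotient structure, given explicitly as in `ManifoldForms`).
[folklore] -/
instance instAddCommGroup {U : Set M} (hU : IsOpen U) : AddCommGroup (LocalDeRham I F k hU) :=
  Submodule.Quotient.addCommGroup _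

/-- The module structure (quotient structure, given explicitly as in `ManifoldForms`).
[folklore] -/
instance instModule {U : Set M} (hU : IsOpen U) : Module ℝ (LocalDeRham I F k hU) :=
  Submodule.Quotient.module _

/-- The class of a closed form on `U`. [folklore] -/
def mk {U : Set M} (hU : IsOpen U) : localClosedForms I F k U →ₗ[ℝ] LocalDeRham I F k hU :=
  Submodule.mkQ _

/-- Every class has a closed representative. [folklore] -/
theorem mk_surjective {U : Set M} (hU : IsOpen U) :
    Function.Surjective (mk (I := I) (F := F) (k := k) hU) :=
  Submodule.mkQ_surjective _

/-- Two closed forms have the same class iff their difference is exact. [folklore] -/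
theorem mk_eq_mk_iff {U : Set M} (hU : IsOpen U) (α β : localClosedForms I F k U) :
    mk hU α = mk hU β ↔ (α : MForm I M F k) - β ∈ localExactForms I F hU k :=
  (Submodule.Quotient.eq _).trans Iff.rfl

/-- A closed form has class `0` iff it is exact. [folklore] -/
theorem mk_eq_zero_iff {U : Set M} (hU : IsOpen U) (α : localClosedForms I F k U) :
    mk hU α = 0 ↔ (α : MForm I M F k) ∈ localExactForms I F hU k :=
  (Submodule.Quotient.mk_eq_zero _).trans Iff.rfl

end LocalDeRham

/-! ### Restriction maps in cohomology -/

omit [IsManifold I ∞ M] in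
/-- Restriction maps closed forms on `V` to closed forms on an open `U ⊆ V`. [cite: BottTu1982Forms, §I.1] -/
theorem restr_mem_localClosedForms {U V : Set M} (hU : IsOpen U) (hUV : U ⊆ V)
    {α : MForm I M F k} (hα : α ∈ localClosedForms I F k V) :
    α.restr U ∈ localClosedForms I F k U :=
  ⟨restr_mem_smoothFormsOn hU hUV hα.1, fun x hx ↦ by
    rw [mextDeriv_restr_apply hU α hx, hα.2 x (hUV hx)]⟩

/-- Restriction maps exact forms on `V` to exact forms on an open `U ⊆ V`. [cite: BottTu1982Forms, §I.1] -/
theorem restr_mem_localExactForms {U V : Set M} (hU : IsOpen U) (hV : IsOpen V) (hUV : U ⊆ V)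
    {α : MForm I M F k} (hα : α ∈ localExactForms I F hV k) :
    α.restr U ∈ localExactForms I F hU k := by
  cases k with
  | zero =>
    rw [localExactForms, Submodule.mem_bot] at hα ⊢
    rw [hα, MForm.restr_zero]
  | succ k =>
    obtain ⟨β, rfl⟩ := (mem_localExactForms_succ_iff hV).1 hα
    refine (mem_localExactForms_succ_iff hU).2 ⟨restrictₗ I F k hU hUV β, ?_⟩
    rw [localD_restrictₗ hU hV hUV β, coe_restrictₗ]

variable (I F k) in
/-- Restriction of closed forms `Z^k(V) → Z^k(U)` for open `U ⊆ V`, as a linear map. [folklore] -/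
def restrictClosedₗ {U V : Set M} (hU : IsOpen U) (hUV : U ⊆ V) :
    localClosedForms I F k V →ₗ[ℝ] localClosedForms I F k U where
  toFun α := ⟨(α : MForm I M F k).restr U, restr_mem_localClosedForms hU hUV α.2⟩
  map_add' _ _ := Subtype.ext (MForm.restr_add U _ _)
  map_smul' c _ := Subtype.ext (MForm.restr_smul U c _)

omit [IsManifold I ∞ M] in
/-- Underlying form of a restricted closed form. [folklore] -/
@[simp]
theorem coe_restrictClosedₗ {U V : Set M} (hU : IsOpen U) (hUV : U ⊆ V)
    (α : localClosedForms I F k V) :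
    (restrictClosedₗ I F k hU hUV α : MForm I M F k) = (α : MForm I M F k).restr U :=
  rfl

variable (I F k) in
/-- **The restriction map in de Rham cohomology** `H^k(V) → H^k(U)` for open `U ⊆ V`
(Bott–Tu (1982), §I.2; functorial: `res_comp`, `res_self`). [cite: BottTu1982Forms, §I.2] -/
def LocalDeRham.res {U V : Set M} (hU : IsOpen U) (hV : IsOpen V) (hUV : U ⊆ V) :
    LocalDeRham I F k hV →ₗ[ℝ] LocalDeRham I F k hU :=
  Submodule.mapQ _ _ (restrictClosedₗ I F k hU hUV)
    fun _ hα ↦ restr_mem_localExactForms hU hV hUV hα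

/-- `res` on the class of a closed form is the class of its restriction. [folklore] -/
theorem LocalDeRham.res_mk {U V : Set M} (hU : IsOpen U) (hV : IsOpen V) (hUV : U ⊆ V)
    (α : localClosedForms I F k V) :
    LocalDeRham.res I F k hU hV hUV (LocalDeRham.mk hV α) =
      LocalDeRham.mk hU (restrictClosedₗ I F k hU hUV α) :=
  rfl

/-- Functoriality of `res`: restricting to `V` and then to `U ⊆ V` is restricting to `U`.
[cite: BottTu1982Forms, §I.2] -/
theorem LocalDeRham.res_comp {U V W : Set M} (hU : IsOpen U) (hV : IsOpen V) (hW : IsOpen W)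
    (hUV : U ⊆ V) (hVW : V ⊆ W) (c : LocalDeRham I F k hW) :
    LocalDeRham.res I F k hU hV hUV (LocalDeRham.res I F k hV hW hVW c) =
      LocalDeRham.res I F k hU hW (hUV.trans hVW) c := by
  obtain ⟨α, rfl⟩ := LocalDeRham.mk_surjective hW c
  rw [LocalDeRham.res_mk, LocalDeRham.res_mk, LocalDeRham.res_mk]
  congr 1
  apply Subtype.ext
  simp only [coe_restrictClosedₗ]
  exact MForm.restr_restr_of_subset hUV _

/-- Functoriality of `res`: restriction from `U` to itself is the identity. [cite: BottTu1982Forms, §I.2] -/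
theorem LocalDeRham.res_self {U : Set M} (hU : IsOpen U) (c : LocalDeRham I F k hU) :
    LocalDeRham.res I F k hU hU le_rfl c = c := by
  obtain ⟨α, rfl⟩ := LocalDeRham.mk_surjective hU c
  rw [LocalDeRham.res_mk]
  congr 1
  apply Subtype.ext
  simp only [coe_restrictClosedₗ]
  exact MForm.restr_eq_self α.2.1.2

/-! ### Comparison with the global de Rham cohomology -/

omit [IsManifold I ∞ M] in
/-- A closed form on `univ` is a closed smooth form on `M`. [folklore] -/
theorem mem_closedSmoothForms_of_mem_localClosedForms_univ {α : MForm I M F k}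
    (hα : α ∈ localClosedForms I F k (univ : Set M)) : α ∈ closedSmoothForms I M F k :=
  ⟨fun x ↦ hα.1.1 x (mem_univ x), funext fun x ↦ hα.2 x (mem_univ x)⟩

omit [IsManifold I ∞ M] in
/-- A closed smooth form on `M` is a closed form on `univ`. [folklore] -/
theorem mem_localClosedForms_univ_of_mem_closedSmoothForms {α : MForm I M F k}
    (hα : α ∈ closedSmoothForms I M F k) : α ∈ localClosedForms I F k (univ : Set M) :=
  ⟨⟨fun x _ ↦ hα.1 x, fun x hx ↦ (hx (mem_univ x)).elim⟩, fun x _ ↦ congrFun hα.2 x⟩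

/-- An exact form on `univ` is an exact smooth form on `M`. [folklore] -/
theorem mem_exactSmoothForms_of_mem_localExactForms_univ {α : MForm I M F k}
    (hα : α ∈ localExactForms I F (isOpen_univ : IsOpen (univ : Set M)) k) :
    α ∈ exactSmoothForms I M F k := by
  cases k with
  | zero =>
    rw [localExactForms, Submodule.mem_bot] at hα
    rw [hα]
    exact Submodule.zero_mem _
  | succ k =>
    obtain ⟨β, rfl⟩ := (mem_localExactForms_succ_iff isOpen_univ).1 hα
    refine Submodule.subset_span ⟨β, ?_, ?_⟩
    · exact fun x ↦ β.2.1 x (mem_univ x)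
    · rw [coe_localD, MForm.restr_univ]

variable (I F k) in
/-- The comparison map `H^k(univ) → H^k_dR(M)` from the local cohomology of `U = univ` to the
de Rham cohomology of `ManifoldForms` (identity on representatives). [folklore] -/
def LocalDeRham.toDeRhamCohomology (M : Type*) [TopologicalSpace M] [ChartedSpace H M]
    [IsManifold I ∞ M] :
    LocalDeRham I F k (isOpen_univ : IsOpen (univ : Set M)) →ₗ[ℝ] deRhamCohomology I M F k :=
  Submodule.mapQ _ _
    { toFun := fun α ↦ ⟨(α : MForm I M F k), mem_closedSmoothForms_of_mem_localClosedForms_univ α.2⟩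
      map_add' := fun _ _ ↦ rfl
      map_smul' := fun _ _ ↦ rfl }
    fun _ hα ↦ mem_exactSmoothForms_of_mem_localExactForms_univ hα

/-- The comparison map `H^k(univ) → H^k_dR(M)` is surjective (every closed smooth form on `M`
is a closed form on `univ`). [folklore] -/
theorem LocalDeRham.toDeRhamCohomology_surjective (M : Type*) [TopologicalSpace M]
    [ChartedSpace H M] [IsManifold I ∞ M] :
    Function.Surjective (LocalDeRham.toDeRhamCohomology I F k M) := by
  intro c
  obtain ⟨α, rfl⟩ := deRhamCohomology.mk_surjective c
  exact ⟨LocalDeRham.mk isOpen_univ ⟨α, mem_localClosedForms_univ_of_mem_closedSmoothForms α.2⟩,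
    rfl⟩

/-- **Finiteness transfers**: if the local de Rham cohomology of `U = univ` is
finite-dimensional, so is `deRhamCohomology I M F k`. [folklore] -/
theorem finite_deRhamCohomology_of_finite_localDeRham_univ (M : Type*) [TopologicalSpace M]
    [ChartedSpace H M] [IsManifold I ∞ M]
    (h : Module.Finite ℝ (LocalDeRham I F k (isOpen_univ : IsOpen (univ : Set M)))) :
    Module.Finite ℝ (deRhamCohomology I M F k) :=
  Module.Finite.of_surjective _ (LocalDeRham.toDeRhamCohomology_surjective M)

end Deriv

end Literature.Geometry.Kaehler
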